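import Summits.ABC.IUTFork.Conditional.AbcOfSGenuineKChosenDepthHexSharpEngineLocalType
import Literature.IUT.LogVolume.SubThetaFieldRamificationSixty
import Literature.IUT.LogVolume.Corollary22LegendreDeepAdmissiblePairs
import Summits.ABC.IUTFork.Conditional.HexBadPlacesOverDeepPrime
import HarnessLib

/-!
# Branch C «HEX-SHARP», LOCAL TYPE at `7` (R-W lane P−, task LT-c): `e(K_x/ℚ_7) ∣ 60·l` at EVERY place over `7` of the `l`-division field of
# EVERY genuine Θ-volume datum over `λ_k = 1/2 + 2/7^k` — hence the top label over `7` is deep for `k ≥ 15` (`l = 11`), `k ≥ 14` (`l = 13`),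
# `k ≥ 13` (every prime `17 ≤ l ≤ 240`), UNCONDITIONALLY

PROOF-ONLY file (0 definitions, 0 `Prop` facts, no instance) of the abc-iut cell (seat abc-iut-w5-d163, gen 7; HEX-SHARP prover #1, owner of
«LT-c» = the `p = 7` assembly, plan g9 C-R40 addenda 2–3; sequel of `AbcOfSGenuineKChosenDepthHexSharpEngine` p457581 and
`…EngineLocalType` p458036). TAKES NO SIDE on [IUTchIII] Cor. 3.12 or on any author.

INPUT LANDED (abc-iut-W-neg-1, «LT-a» = LOCAL-TYPE LEMMA 1/3): `Cor22.ramificationIdx_subThetaField_dvd_sixty` — for `P ∈ U`, `F` Galois over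
`F_tpd` with `IsSubThetaField P F`, and a place `w` of `F` over a BAD place `v ∤ 30` of `λ`: `e(w|v) ∣ 60` (inertia at a potentially multiplicative
place acts on `E_λ[3]`, `E_λ[5]` through groups of order `∣ 6`, `∣ 10` — abc-iut-L5-t12's unipotence p455303 — and on the twist square roots through
`ℤ/2`; S1's two-root frame). THIS FILE (the `p = 7` / HEX assembly):

* §1 `GenuineK.absRamificationIdx_kOf_dvd_sixty_mul` — for `k ≥ 1`, `l` prime `≥ 11` and EVERY genuine Θ-volume datum `T` over `(ratPoint λ_k, l)`:
  **every** place `x | 7` of `T.K` has `e(K_x/ℚ_7) ∣ 60·l` — `e(x|7) = e(v₀|7)·e(v|v₀)·e(x|v)` with `e(v₀|7) = 1` (`F_tpd = ℚ`), `e(v|v₀) ∣ 60`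
  (LT-a at the bad place `(7)` of `λ_k`: `ord_7 j(λ_k) = −2k < 0`, abc-iut-w5-d044's `Cor22.ord_jInv_lamSeven`) and `e(x|v) ∣ l` (p457581 §1's route:
  `Cor22.exists_ramificationIdx_eq_pow_of_ker_le` at the semistable `E_F`, `ramificationIdx_dvd_prime_of_eq_pow`); `…_le_sixty_mul`: `≤ 60·l`.
* §2 the hypothesis binder `hloc60` of p458036 DISCHARGED: **`GenuineK.exists_deep_place_lamSeven_localType_eleven`** (`l = 11`: every `k ≥ 15`),
  **`…_thirteen`** (`l = 13`: every `k ≥ 14`), **`…_of_le_240`** (every prime `17 ≤ l ≤ 240`: every `k ≥ 13`) — the top-label packet over `7`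
  satisfies abc-iut-w5-d107's explicit depth inequality at the CHOSEN realising q-idele (`hdeep` of p438886 ⇒ ¬S_H per datum, one `obtain`).
So the kernel's HEX frontier moves 21/20/21 (p457581) → **15/14/13**; with a cyclic-tame-inertia sharpening `e(v|v₀) ∣ 30` (W-neg-1, if filed) p458036 §2
gives 13/12/11; the numerics of record (rw-num-lead F1-3) read ALLREF for `k ≥ 12` and WINDOW for `k ≤ 9`.

HONEST SCOPE: SHARP reading; the per-label licence is a STRONGER-THAN-PRINT sufficient form of (xi-f); a deep top-label packet says NOTHING about the printed
GLOBAL inequality, the number-level Corollary, or any author's intended hull; the HEX data are Szpiro-GOOD (letter-C insulation); refuted-as-typed ≠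
refuted-in-print; typed ≠ proved. [cite: Mochizuki2012, IUTchIII Cor. 3.12 Step (xi-f) p. 184; IUTchI Ex. 3.2 (iv) p. 71; IUTchIV Prop. 1.2 p. 10,
Prop. 1.8 (vi)–(vii) p. 19, Thm. 1.10 Step (ii) p. 24, Cor. 2.2 (ii) proof (P5) p. 46] [cite: SilvermanAEC2009, Prop. VII.5.1]
[claim: Mochizuki2012, status: disputed] for every IUT quotation.
-/

noncomputable section

open NumberField IsDedekindDomain

namespace Summit.ABC.IUTFork.Conditional

open Thm311 Thm311.Real Cor312 Cor312Prov Literature.IUT.LogVolume Literature.IUT.HodgeTheaters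
  Literature.IUT.LogThetaLattice Literature.NumberTheory.NumberFields Literature.NumberTheory.DiophantineGeometry.GenEll
  Literature.NumberTheory.DiophantineGeometry

/-! ## §1. The local type at `7`: `e(K_x/ℚ_7) ∣ 60·l` at every place over `7` -/

/-- **`e(K_x/ℚ_7) ∣ 60·l` at EVERY place `x | 7` of the `l`-division field of a genuine Θ-volume datum over `λ_k = 1/2 + 2/7^k`** (`k ≥ 1`, `l ≥ 11`
prime): `e(x|7) = e(v|7)·e(x|v)`, `v = x ∩ F`, with `e(v|7) ∣ 60` (abc-iut-W-neg-1's `Cor22.ramificationIdx_subThetaField_dvd_sixty` at the bad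
place `(7)` of `λ_k`) and `e(x|v) ∣ l` ([IUTchIV] Prop. 1.8 (vii) at the semistable `E_F`). [cite: Mochizuki2012, IUTchIV Prop. 1.8 (vi)–(vii) p. 19,
Thm. 1.10 Step (ii) p. 24] [claim: Mochizuki2012, status: disputed] -/
theorem GenuineK.absRamificationIdx_kOf_dvd_sixty_mul {k l : ℕ} (hk : 1 ≤ k) (hl : l.Prime) (h11 : 11 ≤ l)
    (T : Cor22.ThetaVolumeDatumAt (ratPoint ((2 : ℚ)⁻¹ + 2 / 7 ^ k)) l) :
    letI := T.instFieldF; letI := T.instNumberFieldF; letI := T.instAlgebraF; letI := T.instFieldK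
    letI := T.instNumberFieldK; letI := T.instAlgebraK; letI := T.instFieldFbar; letI := T.instAlgebraFbar
    letI := T.instAlgebraKFbar; letI := T.instIsElliptic
    haveI : Fact (Nat.Prime 7) := ⟨by norm_num⟩
    ∀ x : (thetaIndex (pilotDataOfK T.D T.K)).Fibre (.inr ⟨7, by norm_num⟩),
      absRamificationIdx 7 (kOf (pilotDataOfK T.D T.K) 7 x) ∣ 60 * l := by
  letI := T.instFieldF; letI := T.instNumberFieldF; letI := T.instAlgebraF; letI := T.instFieldK
  letI := T.instNumberFieldK; letI := T.instAlgebraK; letI := T.instFieldFbar; letI := T.instAlgebraFbar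
  letI := T.instAlgebraKFbar; letI := T.instIsElliptic
  haveI : Fact (Nat.Prime 7) := ⟨by norm_num⟩
  intro x
  have hU : (ratPoint ((2 : ℚ)⁻¹ + 2 / 7 ^ k)).InU := T.inU
  haveI : Fact l.Prime := ⟨hl⟩
  have h7l : (7 : ℕ) ≠ l := by omega
  -- Galois structure and the embedding `K → AlgebraicClosure F` inside the `l`-division field
  obtain ⟨hGalF, hGalK, -, -, -, -, -, -, -⟩ := T.towerFacts hU
  haveI := hGalF; haveI := hGalK
  haveI := T.D.isScalarTower
  haveI := T.D.isAlgClosure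
  let ι : T.Fbar ≃ₐ[T.F] AlgebraicClosure T.F := IsAlgClosure.equiv T.F T.Fbar (AlgebraicClosure T.F)
  let ψ : T.K →ₐ[T.F] AlgebraicClosure T.F :=
    (ι : T.Fbar →ₐ[T.F] AlgebraicClosure T.F).comp (IsScalarTower.toAlgHom T.F T.K T.Fbar)
  have hK : (T.E.galoisRepTorsion (l : ℤ)).ker ≤ ψ.fieldRange.fixingSubgroup :=
    Cor22.ker_galoisRepTorsion_le_fixingSubgroup_of_initialThetaData T.D ι
  have hss : T.E.IsSemistable (𝓞 T.F) := T.D.isSemistable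
  -- the places `w = placeOf x`, `v = w ∩ F`, `v₀ = v ∩ ℚ`
  set w : HeightOneSpectrum (𝓞 T.K) := placeOf (pilotDataOfK T.D T.K) 7 x with hwdef
  have hpw : ((7 : ℕ) : 𝓞 T.K) ∈ w.asIdeal := natCast_mem_placeOf (pilotDataOfK T.D T.K) 7 x
  set v : HeightOneSpectrum (𝓞 T.F) := finBelow T.F T.K w with hvdef
  set v₀ : HeightOneSpectrum (𝓞 (ratPoint ((2 : ℚ)⁻¹ + 2 / 7 ^ k)).F) :=
    finBelow (ratPoint ((2 : ℚ)⁻¹ + 2 / 7 ^ k)).F T.F v with hv₀def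
  have hw_under : w.under (𝓞 T.F) = v := rfl
  have hv_under : v.under (𝓞 (ratPoint ((2 : ℚ)⁻¹ + 2 / 7 ^ k)).F) = v₀ := rfl
  have hpv : ((7 : ℕ) : 𝓞 T.F) ∈ v.asIdeal := by
    change ((7 : ℕ) : 𝓞 T.F) ∈ w.asIdeal.under (𝓞 T.F)
    rw [Ideal.under_def, Ideal.mem_comap, map_natCast]
    exact hpw
  have hpv₀ : ((7 : ℕ) : 𝓞 (ratPoint ((2 : ℚ)⁻¹ + 2 / 7 ^ k)).F) ∈ v₀.asIdeal := by
    change ((7 : ℕ) : 𝓞 (ratPoint ((2 : ℚ)⁻¹ + 2 / 7 ^ k)).F) ∈ v.asIdeal.under (𝓞 (ratPoint ((2 : ℚ)⁻¹ + 2 / 7 ^ k)).F)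
    rw [Ideal.under_def, Ideal.mem_comap, map_natCast]
    exact hpv
  have hwchar : residueChar T.K w = 7 := residueChar_eq_of_natCast_mem 7 hpw
  -- the same place read over `ℚ` (`F_tpd = ℚ` definitionally): `v₀ = (7)` is a BAD place of `λ_k` and `30 ∉ v₀`
  let u₀ : HeightOneSpectrum (𝓞 ℚ) := v₀
  have hpu₀ : ((7 : ℕ) : 𝓞 ℚ) ∈ u₀.asIdeal := hpv₀
  have hu₀char : residueChar ℚ u₀ = 7 := residueChar_eq_of_natCast_mem 7 hpu₀
  have hu₀gen : Rat.HeightOneSpectrum.natGenerator u₀ = 7 := by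
    have h := Hex.residueChar_rat_eq_natGenerator u₀
    rw [hu₀char] at h
    exact h.symm
  have hu₀bad : u₀ ∈ Cor22.badPlaces (ratPoint ((2 : ℚ)⁻¹ + 2 / 7 ^ k)) :=
    (Cor22.mem_badPlaces_iff_ord_neg (ratPoint ((2 : ℚ)⁻¹ + 2 / 7 ^ k)) u₀).mpr
      (Cor22.ord_jInv_lamSeven_neg u₀ hu₀gen hk)
  have hv₀bad : finBelow (ratPoint ((2 : ℚ)⁻¹ + 2 / 7 ^ k)).F T.F v ∈
      Cor22.badPlaces (ratPoint ((2 : ℚ)⁻¹ + 2 / 7 ^ k)) := hu₀bad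
  have h30 : ((30 : ℕ) : 𝓞 (ratPoint ((2 : ℚ)⁻¹ + 2 / 7 ^ k)).F) ∉
      (finBelow (ratPoint ((2 : ℚ)⁻¹ + 2 / 7 ^ k)).F T.F v).asIdeal := by
    intro h
    have h' : ((30 : ℕ) : 𝓞 ℚ) ∈ u₀.asIdeal := h
    rw [Hex.natCast_mem_asIdeal_iff_residueChar_dvd, hu₀char] at h'
    omega
  -- `e(K_x) = e(w|7) = e(v|7)·e(w|v)`, `e(v|7) = ramIdx ℚ v₀ · e(v|v₀) = e(v|v₀)`
  have hekOf : absRamificationIdx 7 (kOf (pilotDataOfK T.D T.K) 7 x) = w.asIdeal.ramificationIdx ℤ := by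
    rw [show absRamificationIdx 7 (kOf (pilotDataOfK T.D T.K) 7 x) =
        absRamificationIdx 7 (RescaledCompletion T.K 7 (placeOf (pilotDataOfK T.D T.K) 7 x)
          (natCast_mem_placeOf (pilotDataOfK T.D T.K) 7 x)) from rfl,
      absRamificationIdx_rescaledCompletion]
  haveI hwv : w.asIdeal.LiesOver v.asIdeal := by rw [← hw_under]; exact ⟨rfl⟩
  haveI hvv₀ : v.asIdeal.LiesOver v₀.asIdeal := by rw [← hv_under]; exact ⟨rfl⟩
  haveI : v.asIdeal.IsMaximal := v.isMaximal
  haveI : v₀.asIdeal.IsMaximal := v₀.isMaximal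
  have hewv : Ideal.ramificationIdx' v.asIdeal w.asIdeal = w.asIdeal.ramificationIdx (𝓞 T.F) :=
    Ideal.ramificationIdx'_eq_ramificationIdx v.asIdeal w.asIdeal v.ne_bot
  have hevv₀ : Ideal.ramificationIdx' v₀.asIdeal v.asIdeal = v.asIdeal.ramificationIdx (𝓞 (ratPoint ((2 : ℚ)⁻¹ + 2 / 7 ^ k)).F) :=
    Ideal.ramificationIdx'_eq_ramificationIdx v₀.asIdeal v.asIdeal v₀.ne_bot
  have hram₀ : ramIdx (ratPoint ((2 : ℚ)⁻¹ + 2 / 7 ^ k)).F v₀ = 1 := by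
    have h1 := ramificationIdx_int_le_finrank_rat (F₀ := (ratPoint ((2 : ℚ)⁻¹ + 2 / 7 ^ k)).F) v₀
    rw [show Module.finrank ℚ (ratPoint ((2 : ℚ)⁻¹ + 2 / 7 ^ k)).F = 1 from Module.finrank_self ℚ, ← ramIdx_eq] at h1
    have h2 : ramIdx (ratPoint ((2 : ℚ)⁻¹ + 2 / 7 ^ k)).F v₀ ≠ 0 := ramIdx_ne_zero (ratPoint ((2 : ℚ)⁻¹ + 2 / 7 ^ k)).F v₀
    omega
  have hew : w.asIdeal.ramificationIdx ℤ =
      v.asIdeal.ramificationIdx (𝓞 (ratPoint ((2 : ℚ)⁻¹ + 2 / 7 ^ k)).F) * w.asIdeal.ramificationIdx (𝓞 T.F) := by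
    rw [ThetaData.absRamificationIdx_eq_ramIdx_mul (F := T.F) w, hw_under, ramIdx_eq,
      ThetaData.absRamificationIdx_eq_ramIdx_mul (F := (ratPoint ((2 : ℚ)⁻¹ + 2 / 7 ^ k)).F) v, hv_under, hram₀, one_mul, hevv₀, hewv]
  -- `e(v|v₀) ∣ 60` (LT-a) and `e(w|v) ∣ l`
  have hev60 : v.asIdeal.ramificationIdx (𝓞 (ratPoint ((2 : ℚ)⁻¹ + 2 / 7 ^ k)).F) ∣ 60 :=
    Cor22.ramificationIdx_subThetaField_dvd_sixty T.F hU T.isSubThetaField v hv₀bad h30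
  have hlw : ((l : ℕ) : 𝓞 T.F) ∉ (finBelow T.F T.K w).asIdeal :=
    Cor22.natCast_notMem_finBelow_of_residueChar_ne hl w (by rw [hwchar]; exact h7l)
  have hewdvd : w.asIdeal.ramificationIdx (𝓞 T.F) ∣ l := by
    obtain ⟨m, hm⟩ := Cor22.exists_ramificationIdx_eq_pow_of_ker_le ψ hss T.j_eq hl hK w hlw
    exact ramificationIdx_dvd_prime_of_eq_pow w hl hm (Cor22.finrank_dvd_of_ker_le ψ hK)
  rw [hekOf, hew]
  exact mul_dvd_mul hev60 hewdvd

/-- **`e(K_x/ℚ_7) ≤ 60·l`** at every place over `7` (the `≤` form consumed by the parametric engine p458036).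
[cite: Mochizuki2012, IUTchIV Prop. 1.8 (vii) p. 19] [claim: Mochizuki2012, status: disputed] -/
theorem GenuineK.absRamificationIdx_kOf_le_sixty_mul {k l : ℕ} (hk : 1 ≤ k) (hl : l.Prime) (h11 : 11 ≤ l)
    (T : Cor22.ThetaVolumeDatumAt (ratPoint ((2 : ℚ)⁻¹ + 2 / 7 ^ k)) l) :
    letI := T.instFieldF; letI := T.instNumberFieldF; letI := T.instAlgebraF; letI := T.instFieldK
    letI := T.instNumberFieldK; letI := T.instAlgebraK; letI := T.instFieldFbar; letI := T.instAlgebraFbar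
    letI := T.instAlgebraKFbar; letI := T.instIsElliptic
    haveI : Fact (Nat.Prime 7) := ⟨by norm_num⟩
    ∀ x : (thetaIndex (pilotDataOfK T.D T.K)).Fibre (.inr ⟨7, by norm_num⟩),
      absRamificationIdx 7 (kOf (pilotDataOfK T.D T.K) 7 x) ≤ 60 * l := by
  intro x
  exact Nat.le_of_dvd (by have := hl.pos; positivity) (GenuineK.absRamificationIdx_kOf_dvd_sixty_mul hk hl h11 T x)

/-! ## §2. The local-type corollaries of p458036, UNCONDITIONAL -/

/-- **HEX-SHARP with the local type, `l = 11`: every `k ≥ 15`** — the top-label packet over `7` (`i = 4`) is deep at every genuine Θ-volume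
datum over `(ratPoint λ_k, 11)` (p458036 `…_of_localType60_eleven` with `hloc60` discharged by §1). [cite: Mochizuki2012, IUTchIII Cor. 3.12 Step (xi-f) p. 184;
IUTchIV Prop. 1.2 p. 10] [claim: Mochizuki2012, status: disputed] -/
theorem GenuineK.exists_deep_place_lamSeven_localType_eleven {k : ℕ} (hk : 15 ≤ k)
    (T : Cor22.ThetaVolumeDatumAt (ratPoint ((2 : ℚ)⁻¹ + 2 / 7 ^ k)) 11) :
    letI := T.instFieldF; letI := T.instNumberFieldF; letI := T.instAlgebraF; letI := T.instFieldK
    letI := T.instNumberFieldK; letI := T.instAlgebraK; letI := T.instFieldFbar; letI := T.instAlgebraFbar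
    letI := T.instAlgebraKFbar; letI := T.instIsElliptic
    haveI : Fact (Nat.Prime 7) := ⟨by norm_num⟩
    ∃ (i : Fin (thetaIndex (pilotDataOfK T.D T.K)).lstar) (x₀ : (thetaIndex (pilotDataOfK T.D T.K)).Fibre (.inr ⟨7, by norm_num⟩)),
      (i : ℕ) = 4 ∧
      placeOf (pilotDataOfK T.D T.K) 7 x₀ ∈ (pilotDataOfK T.D T.K).S ∧
      (7 : ℝ) ^ ((((i : ℕ) : ℝ) + 2) * (differentOrd 7 (kOf (pilotDataOfK T.D T.K) 7 x₀)
          + logRadiusA 7 (absRamificationIdx 7 (kOf (pilotDataOfK T.D T.K) 7 x₀))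
          + logRadiusB 7 (absRamificationIdx 7 (kOf (pilotDataOfK T.D T.K) 7 x₀))) + 1) *
        ‖(exists_realising_qIdeles_pilotDataOfK T.D).choose ⟨7, by norm_num⟩ x₀‖ ^ (((i : ℕ) + 1) ^ 2 - 1) < 1 :=
  GenuineK.exists_deep_place_lamSeven_of_localType60_eleven hk T
    (GenuineK.absRamificationIdx_kOf_le_sixty_mul (by omega) (by norm_num) le_rfl T)

/-- **HEX-SHARP with the local type, `l = 13`: every `k ≥ 14`.** [cite: Mochizuki2012, IUTchIII Cor. 3.12 Step (xi-f) p. 184; IUTchIV Prop. 1.2 p. 10]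
[claim: Mochizuki2012, status: disputed] -/
theorem GenuineK.exists_deep_place_lamSeven_localType_thirteen {k : ℕ} (hk : 14 ≤ k)
    (T : Cor22.ThetaVolumeDatumAt (ratPoint ((2 : ℚ)⁻¹ + 2 / 7 ^ k)) 13) :
    letI := T.instFieldF; letI := T.instNumberFieldF; letI := T.instAlgebraF; letI := T.instFieldK
    letI := T.instNumberFieldK; letI := T.instAlgebraK; letI := T.instFieldFbar; letI := T.instAlgebraFbar
    letI := T.instAlgebraKFbar; letI := T.instIsElliptic
    haveI : Fact (Nat.Prime 7) := ⟨by norm_num⟩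
    ∃ (i : Fin (thetaIndex (pilotDataOfK T.D T.K)).lstar) (x₀ : (thetaIndex (pilotDataOfK T.D T.K)).Fibre (.inr ⟨7, by norm_num⟩)),
      (i : ℕ) = 5 ∧
      placeOf (pilotDataOfK T.D T.K) 7 x₀ ∈ (pilotDataOfK T.D T.K).S ∧
      (7 : ℝ) ^ ((((i : ℕ) : ℝ) + 2) * (differentOrd 7 (kOf (pilotDataOfK T.D T.K) 7 x₀)
          + logRadiusA 7 (absRamificationIdx 7 (kOf (pilotDataOfK T.D T.K) 7 x₀))
          + logRadiusB 7 (absRamificationIdx 7 (kOf (pilotDataOfK T.D T.K) 7 x₀))) + 1) *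
        ‖(exists_realising_qIdeles_pilotDataOfK T.D).choose ⟨7, by norm_num⟩ x₀‖ ^ (((i : ℕ) + 1) ^ 2 - 1) < 1 :=
  GenuineK.exists_deep_place_lamSeven_of_localType60_thirteen hk T
    (GenuineK.absRamificationIdx_kOf_le_sixty_mul (by omega) (by norm_num) (by norm_num) T)

/-- **HEX-SHARP with the local type, every prime `17 ≤ l ≤ 240`: every `k ≥ 13`.** [cite: Mochizuki2012, IUTchIII Cor. 3.12 Step (xi-f) p. 184;
IUTchIV Prop. 1.2 p. 10] [claim: Mochizuki2012, status: disputed] -/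
theorem GenuineK.exists_deep_place_lamSeven_localType_of_le_240 {k l : ℕ} (hk : 13 ≤ k) (hl : l.Prime) (h17 : 17 ≤ l)
    (h240 : l ≤ 240) (T : Cor22.ThetaVolumeDatumAt (ratPoint ((2 : ℚ)⁻¹ + 2 / 7 ^ k)) l) :
    letI := T.instFieldF; letI := T.instNumberFieldF; letI := T.instAlgebraF; letI := T.instFieldK
    letI := T.instNumberFieldK; letI := T.instAlgebraK; letI := T.instFieldFbar; letI := T.instAlgebraFbar
    letI := T.instAlgebraKFbar; letI := T.instIsElliptic
    haveI : Fact (Nat.Prime 7) := ⟨by norm_num⟩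
    ∃ (i : Fin (thetaIndex (pilotDataOfK T.D T.K)).lstar) (x₀ : (thetaIndex (pilotDataOfK T.D T.K)).Fibre (.inr ⟨7, by norm_num⟩)),
      (i : ℕ) = (l - 1) / 2 - 1 ∧
      placeOf (pilotDataOfK T.D T.K) 7 x₀ ∈ (pilotDataOfK T.D T.K).S ∧
      (7 : ℝ) ^ ((((i : ℕ) : ℝ) + 2) * (differentOrd 7 (kOf (pilotDataOfK T.D T.K) 7 x₀)
          + logRadiusA 7 (absRamificationIdx 7 (kOf (pilotDataOfK T.D T.K) 7 x₀))
          + logRadiusB 7 (absRamificationIdx 7 (kOf (pilotDataOfK T.D T.K) 7 x₀))) + 1) *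
        ‖(exists_realising_qIdeles_pilotDataOfK T.D).choose ⟨7, by norm_num⟩ x₀‖ ^ (((i : ℕ) + 1) ^ 2 - 1) < 1 :=
  GenuineK.exists_deep_place_lamSeven_of_localType60_of_le_240 hk hl h17 h240 T
    (GenuineK.absRamificationIdx_kOf_le_sixty_mul (by omega) hl (by omega) T)

end Summit.ABC.IUTFork.Conditional

end
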